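import Summits.CriticalPhenomena.SAWScalingLimit.Theorems.BoundaryClosureNegative_HalfDisc

/-!
# Negative knowledge on crux `BoundaryClosure` — the corridor refutation of `HexObservableLimit`, part 2: the explicit conformal map `Φ_r = Möbius ∘ square ∘ Cayley` of the half-disc onto `ℍ` (`r ↦ ∞`, `0 ↦ 0`) and its rational form `Φ_r z = (1-r)² z/((r-z)(1-rz))`.

Support for `SAWDefectDecoherenceHexObservableLimitRefutation.lean` (item stmt-CriticalPhenomena-5420, the conclusion of
crux `BoundaryClosure`, stmt-CriticalPhenomena-8536). Everything proved. [folklore]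
-/

noncomputable section

open Set Filter Topology Complex
open Literature.Probability.RandomPlanarGeometry
open UpperHalfPlane (upperHalfPlaneSet)

namespace Summit.CriticalPhenomena.SAWScalingLimit.Theorems.BoundaryClosure.Negative

/-! ### Three explicit conformal equivalences -/

/-- The open first quadrant. [folklore] -/
def Q1 : Set ℂ := {z | 0 < z.re ∧ 0 < z.im}

/-- Points of the half-disc are not `1`. [folklore] -/
theorem one_sub_ne_zero_of_mem_HD {z : ℂ} (hz : z ∈ HD) : (1 : ℂ) - z ≠ 0 := by
  intro h
  have : z = 1 := (sub_eq_zero.1 h).symm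
  rw [this] at hz
  simp [HD] at hz

/-- **The Cayley-type map** `z ↦ (1+z)/(1-z)` of the half-disc onto the first quadrant. [folklore] -/
def cayleyCE : ConformalEquiv HD Q1 where
  toFun z := (1 + z) / (1 - z)
  invFun ζ := (ζ - 1) / (ζ + 1)
  source := HD
  target := Q1
  map_source' := by
    rintro z hz
    have hne := one_sub_ne_zero_of_mem_HD hz
    obtain ⟨hz1, hz2⟩ := hz
    have hns : 0 < Complex.normSq (1 - z) := Complex.normSq_pos.2 hne
    have hn2 : z.re ^ 2 + z.im ^ 2 < 1 := by
      have h := hz1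
      have : ‖z‖ ^ 2 < 1 := by nlinarith [norm_nonneg z]
      rw [Complex.sq_norm, Complex.normSq_apply] at this
      nlinarith
    have ens : Complex.normSq (1 - z) = (1 - z.re) ^ 2 + z.im ^ 2 := by
      rw [Complex.normSq_apply]; simp; ring
    constructor
    · rw [Complex.div_re]
      simp only [Complex.add_re, Complex.one_re, Complex.sub_re, Complex.add_im, Complex.one_im,
        Complex.sub_im, zero_add, zero_sub]
      rw [← add_div]
      apply div_pos _ hns
      nlinarith
    · rw [Complex.div_im]
      simp only [Complex.add_re, Complex.one_re, Complex.sub_re, Complex.add_im, Complex.one_im,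
        Complex.sub_im, zero_add, zero_sub]
      rw [← sub_div]
      apply div_pos _ hns
      nlinarith
  map_target' := by
    rintro ζ ⟨h1, h2⟩
    have hne : ζ + 1 ≠ 0 := by
      intro h; have := congrArg Complex.re h; simp at this; linarith
    have hns : 0 < Complex.normSq (ζ + 1) := Complex.normSq_pos.2 hne
    constructor
    · rw [norm_div, div_lt_one (norm_pos_iff.2 hne)]
      have e1 : ‖ζ - 1‖ ^ 2 = (ζ.re - 1) ^ 2 + ζ.im ^ 2 := by
        rw [Complex.sq_norm, Complex.normSq_apply]; simp; ring
      have e2 : ‖ζ + 1‖ ^ 2 = (ζ.re + 1) ^ 2 + ζ.im ^ 2 := by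
        rw [Complex.sq_norm, Complex.normSq_apply]; simp; ring
      have : ‖ζ - 1‖ ^ 2 < ‖ζ + 1‖ ^ 2 := by rw [e1, e2]; nlinarith
      exact (pow_lt_pow_iff_left₀ (norm_nonneg _) (norm_nonneg _) two_ne_zero).1 this
    · rw [Complex.div_im]
      simp only [Complex.sub_im, Complex.one_im, sub_zero, Complex.add_re, Complex.one_re,
        Complex.sub_re, Complex.add_im, add_zero]
      rw [← sub_div]
      apply div_pos _ hns
      nlinarith
  left_inv' z hz := by
    have hne := one_sub_ne_zero_of_mem_HD hz
    field_simp
    ring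
  right_inv' ζ hζ := by
    have hne : ζ + 1 ≠ 0 := by
      intro h; have := congrArg Complex.re h; simp at this; linarith [hζ.1]
    field_simp
    ring
  source_eq := rfl
  target_eq := rfl
  differentiableOn :=
    (differentiableOn_const _ |>.add differentiableOn_id).div
      (differentiableOn_const _ |>.sub differentiableOn_id) fun _ hz => one_sub_ne_zero_of_mem_HD hz
  differentiableOn_symm := by
    refine (differentiableOn_id.sub (differentiableOn_const _)).div
      (differentiableOn_id.add (differentiableOn_const _)) fun ζ hζ => ?_
    intro h; have := congrArg Complex.re h; simp at this; linarith [hζ.1]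

/-- The principal square root of a point of the upper half-plane lies in the first quadrant. [folklore] -/
theorem cpow_half_mem_Q1 {w : ℂ} (hw : 0 < w.im) : w ^ (2⁻¹ : ℂ) ∈ Q1 := by
  have hw0 : w ≠ 0 := fun h => by rw [h] at hw; simp at hw
  have harg0 : 0 < Complex.arg w := by
    rcases (Complex.arg_nonneg_iff.2 hw.le).lt_or_eq with h | h
    · exact h
    · exfalso
      have := (Complex.arg_eq_zero_iff.1 h.symm).2
      linarith
  have hargπ : Complex.arg w < Real.pi := by
    rcases (Complex.arg_le_pi w).lt_or_eq with h | h
    · exact h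
    · exfalso
      have := (Complex.arg_eq_pi_iff.1 h).2
      linarith
  rw [Complex.cpow_def_of_ne_zero hw0]
  have h2 : (2⁻¹ : ℂ) = ((2⁻¹ : ℝ) : ℂ) := by push_cast; rfl
  have him : (Complex.log w * 2⁻¹).im = Complex.arg w / 2 := by
    rw [h2, Complex.mul_im, Complex.ofReal_re, Complex.ofReal_im, Complex.log_im]; ring
  constructor
  · rw [Complex.exp_re, him]
    exact mul_pos (Real.exp_pos _) (Real.cos_pos_of_mem_Ioo ⟨by linarith, by linarith⟩)
  · rw [Complex.exp_im, him]
    exact mul_pos (Real.exp_pos _) (Real.sin_pos_of_pos_of_lt_pi (by linarith) (by linarith))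

/-- **The squaring map** of the first quadrant onto the upper half-plane. [folklore] -/
def sqCE : ConformalEquiv Q1 upperHalfPlaneSet where
  toFun z := z ^ 2
  invFun w := w ^ (2⁻¹ : ℂ)
  source := Q1
  target := upperHalfPlaneSet
  map_source' := by
    rintro z ⟨h1, h2⟩
    show 0 < (z ^ 2).im
    rw [pow_two, Complex.mul_im]
    nlinarith
  map_target' := fun _ hw => cpow_half_mem_Q1 hw
  left_inv' z hz := Complex.sq_cpow_two_inv hz.1
  right_inv' w _ := Complex.cpow_ofNat_inv_pow w 2
  source_eq := rfl
  target_eq := rfl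
  differentiableOn := differentiableOn_id.pow 2
  differentiableOn_symm := by
    intro w hw
    have : w ∈ Complex.slitPlane := Complex.mem_slitPlane_iff.2 (Or.inr (ne_of_gt hw))
    exact (Complex.hasStrictDerivAt_cpow_const this).hasDerivAt.differentiableAt.differentiableWithinAt

/-- **The real Möbius map** `w ↦ (w-1)/(R-w)` of the upper half-plane (`R > 1`): `1 ↦ 0`, `R ↦ ∞`.
[folklore] -/
def moebCE (R : ℝ) (hR : 1 < R) : ConformalEquiv upperHalfPlaneSet upperHalfPlaneSet where
  toFun w := (w - 1) / (R - w)
  invFun v := (R * v + 1) / (v + 1)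
  source := upperHalfPlaneSet
  target := upperHalfPlaneSet
  map_source' := by
    intro w hw
    change 0 < w.im at hw
    have hne : (R : ℂ) - w ≠ 0 := by
      intro h; have := congrArg Complex.im h; simp at this; linarith
    have hns : 0 < Complex.normSq ((R : ℂ) - w) := Complex.normSq_pos.2 hne
    show 0 < ((w - 1) / (R - w)).im
    rw [Complex.div_im]
    simp only [Complex.sub_im, Complex.one_im, sub_zero, Complex.sub_re, Complex.ofReal_re,
      Complex.one_re, Complex.ofReal_im, zero_sub]
    rw [← sub_div]
    apply div_pos _ hns
    nlinarith
  map_target' := by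
    intro v hv
    change 0 < v.im at hv
    have hne : v + 1 ≠ 0 := by
      intro h; have := congrArg Complex.im h; simp at this; linarith
    have hns : 0 < Complex.normSq (v + 1) := Complex.normSq_pos.2 hne
    show 0 < ((R * v + 1) / (v + 1)).im
    rw [Complex.div_im]
    simp only [Complex.add_im, Complex.mul_im, Complex.ofReal_re, Complex.ofReal_im, zero_mul, add_zero,
      Complex.one_im, Complex.add_re, Complex.one_re, Complex.mul_re, sub_zero]
    rw [← sub_div]
    apply div_pos _ hns
    nlinarith
  left_inv' w hw := by
    change 0 < w.im at hw
    have hne : (R : ℂ) - w ≠ 0 := by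
      intro h; have := congrArg Complex.im h; simp at this; linarith
    have hR1 : (R : ℂ) - 1 ≠ 0 := by
      intro h; have := congrArg Complex.re h; simp at this; linarith
    have e1 : (R : ℂ) * ((w - 1) / (R - w)) + 1 = (R - 1) * w / (R - w) := by
      field_simp; ring
    have e2 : (w - 1) / ((R : ℂ) - w) + 1 = (R - 1) / (R - w) := by
      field_simp; ring
    show ((R : ℂ) * ((w - 1) / (R - w)) + 1) / ((w - 1) / (R - w) + 1) = w
    rw [e1, e2, div_div_div_cancel_right₀ hne, mul_div_cancel_left₀ w hR1]
  right_inv' v hv := by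
    change 0 < v.im at hv
    have hne : v + 1 ≠ 0 := by
      intro h; have := congrArg Complex.im h; simp at this; linarith
    have hR1 : (R : ℂ) - 1 ≠ 0 := by
      intro h; have := congrArg Complex.re h; simp at this; linarith
    have e1 : ((R : ℂ) * v + 1) / (v + 1) - 1 = (R - 1) * v / (v + 1) := by
      field_simp; ring
    have e2 : (R : ℂ) - ((R : ℂ) * v + 1) / (v + 1) = (R - 1) / (v + 1) := by
      field_simp; ring
    show (((R : ℂ) * v + 1) / (v + 1) - 1) / (R - ((R : ℂ) * v + 1) / (v + 1)) = v
    rw [e1, e2, div_div_div_cancel_right₀ hne, mul_div_cancel_left₀ v hR1]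
  source_eq := rfl
  target_eq := rfl
  differentiableOn := by
    refine (differentiableOn_id.sub (differentiableOn_const _)).div
      ((differentiableOn_const _).sub differentiableOn_id) fun w hw => ?_
    change 0 < w.im at hw
    intro h; have := congrArg Complex.im h; simp at this; linarith
  differentiableOn_symm := by
    refine ((differentiableOn_const _).mul differentiableOn_id |>.add (differentiableOn_const _)).div
      (differentiableOn_id.add (differentiableOn_const _)) fun v hv => ?_
    change 0 < v.im at hv
    intro h; have := congrArg Complex.im h; simp at this; linarith

/-- `((1+r)/(1-r))² > 1` for `r ∈ (0,1)`. [folklore] -/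
theorem one_lt_Rr {r : ℝ} (hr : 0 < r ∧ r < 1) : 1 < ((1 + r) / (1 - r)) ^ 2 := by
  have h1 : 1 < (1 + r) / (1 - r) := by rw [lt_div_iff₀ (by linarith)]; linarith
  nlinarith

/-- **The conformal map `Φ_r` of the half-disc onto the upper half-plane** with `r ↦ ∞`, `0 ↦ 0`,
as the composite Möbius ∘ square ∘ Cayley. [folklore] -/
def PhiCE (r : ℝ) (hr : 0 < r ∧ r < 1) : ConformalEquiv HD upperHalfPlaneSet :=
  (cayleyCE.trans sqCE).trans (moebCE (((1 + r) / (1 - r)) ^ 2) (one_lt_Rr hr))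

/-- The rational function `Φ_r(z) = (1-r)² z / ((r-z)(1-rz))`. [folklore] -/
def phiR (r : ℝ) (z : ℂ) : ℂ := (1 - r) ^ 2 * z / ((r - z) * (1 - r * z))

/-- On the half-disc the denominators of `Φ_r` do not vanish. [folklore] -/
theorem denom_ne_zero {r : ℝ} (hr : 0 < r ∧ r < 1) {z : ℂ} (hz : 0 < z.im) :
    (r : ℂ) - z ≠ 0 ∧ (1 : ℂ) - r * z ≠ 0 := by
  constructor
  · intro h; have := congrArg Complex.im h; simp at this; linarith
  · intro h; have := congrArg Complex.im h; simp at this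
    rcases this with h' | h'
    · linarith [hr.1]
    · linarith

/-- **`Φ_r` is the rational function `phiR r` on the half-disc.** [folklore] -/
theorem PhiCE_apply {r : ℝ} (hr : 0 < r ∧ r < 1) {z : ℂ} (hz : z ∈ HD) : PhiCE r hr z = phiR r z := by
  have h1 := one_sub_ne_zero_of_mem_HD hz
  obtain ⟨h3, h4⟩ := denom_ne_zero hr hz.2
  have h2 : (1 : ℂ) - r ≠ 0 := by
    intro h; have := congrArg Complex.re h; simp at this; linarith [hr.2]
  show ((((1 + z) / (1 - z)) ^ 2 - 1) / ((((1 + r) / (1 - r)) ^ 2 : ℝ) - ((1 + z) / (1 - z)) ^ 2)) = phiR r z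
  have h5 : ((((1 + r) / (1 - r)) ^ 2 : ℝ) : ℂ) - ((1 + z) / (1 - z)) ^ 2 ≠ 0 := by
    push_cast
    rw [div_pow, div_pow, div_sub_div _ _ (pow_ne_zero 2 h2) (pow_ne_zero 2 h1)]
    refine div_ne_zero ?_ (mul_ne_zero (pow_ne_zero 2 h2) (pow_ne_zero 2 h1))
    have : ((1 : ℂ) + r) ^ 2 * (1 - z) ^ 2 - (1 - r) ^ 2 * (1 + z) ^ 2 = 4 * (r - z) * (1 - r * z) := by ring
    rw [this]; exact mul_ne_zero (mul_ne_zero (by norm_num) h3) h4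
  rw [phiR, div_eq_div_iff h5 (mul_ne_zero h3 h4)]
  push_cast
  field_simp
  ring


end Summit.CriticalPhenomena.SAWScalingLimit.Theorems.BoundaryClosure.Negative
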